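/-
Copyright (c) 2026. All rights reserved.
Released under Apache 2.0 license as described in the file LICENSE.
Authors: HodgeCM publication cell (pub-hodgecm), DAG-node prover lineage #14 (gen 6: statements and proofs;
gen 7: tree port).
-/
import Literature.Analysis.Distribution.SchwartzBoundedConvergence
import Mathlib.Analysis.Distribution.SchwartzSpace.Deriv
import Mathlib.Analysis.Calculus.Deriv.Slope
import HarnessLib

/-!
# Smooth vectors for translation flows on Schwartz space — any dimension, any displacement curve

Topic `Analysis/Distribution`; namespace `Literature.Analysis.Distribution`.  For a displacement curve
`v : ℝ → E` with `v 0 = 0` and `HasDerivAt v a 0`, the translates `τ_{v s} Φ = Φ(· - v s)`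
(`SchwartzMap.compSubConstCLM`) of a Schwartz function `Φ ∈ 𝓢(E, F)` satisfy

  `s⁻¹ • (τ_{v s} Φ - Φ) ⟶ -∂_{a} Φ`   in the Schwartz topology of `𝓢(E, F)`, `s → 0`, `s ≠ 0`,

for every real normed space `E` and every real normed target `F` (`tendsto_compSubConstCLM_sub_div`; the
straight line `v s = s • a`: `tendsto_compSubConstCLM_smul_sub_div'`).  This is the statement that Schwartz
functions are smooth vectors of the translation group, with generator `-∂_a` (M. Reed, B. Simon, *Methods of
Modern Mathematical Physics I*, §V.3 [ReedSimonI1980]; L. Hörmander, *ALPDO I*, §7.1 [HormanderALPDO1]), in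
the strong form "convergence of the difference quotients in `𝓢`", which is what the differentiation of
matrix coefficients `s ↦ T(τ_{v s} Φ)` against an arbitrary tempered `T` requires.  It is the translation
counterpart of `SchwartzLinearFlowDeriv` (linear flows `Φ ∘ L(s)`); the proof is direct — mean value
estimates (`seminorm_compSubConstCLM_sub_self_le`: `p_{k,n}(τ_v Φ - Φ) ≤ 2^k (p_{k,n+1}(Φ) + p_{0,n+1}(Φ)) ‖v‖`
for `‖v‖ ≤ 1`; `norm_translate_sub_add_fderiv_le`: `‖Φ(x - v) - Φ(x) + DΦ(x) v‖ ≤ p_{0,2}(Φ) ‖v‖²`) fed into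
the bounded-plus-uniform criterion `tendsto_of_seminorm_bounded_of_uniform` — no Fourier transform, no finite
dimension.

Relation to existing tree results: `Literature.MathematicalPhysics.QuantumLattice.seminorm_compSubConstCLM_sub_le`
(file `QuantumLattice/SchwartzTranslationCutoff`) is the same `O(‖v‖)` seminorm estimate with a
sup-of-seminorms constant, used there for continuity of translation; the version here carries the explicit
two-seminorm constant the difference-quotient argument consumes and keeps `Analysis/` free of
`MathematicalPhysics/` imports.  `Distribution.hasDerivAt_apply_translate` (test functions `𝓓`, finite-order
functionals) is a different statement.

Design: `v` is an arbitrary curve (hypotheses `hv0 : v 0 = 0`, `hv : HasDerivAt v a 0`), so that curved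
one-parameter families of translations (e.g. the translation part of a Heisenberg-group action) are covered;
the scalar field `𝕜` of `compSubConstCLM` is a parameter.  NOT here: base points `s₀ ≠ 0` and joint smoothness
(file `SchwartzFlowSmooth`), modulations `e^{i s ⟪ξ, x⟫} Φ`.

Provenance: tree port (LEAN-IN-TREE, 2026-08-18) of the HodgeCM publication cell's package file
`HodgeCM/Automorphic/SchwartzTranslationFlowDeriv.lean` (unit `pub-hodgecm-pv14-g6`, gate run 31; namespace
`HodgeCM.SchwartzWeil` ↦ `Literature.Analysis.Distribution`, statements verbatim).  Nothing in this file is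
specific to that cell or under adjudication there.
-/

set_option autoImplicit false

noncomputable section

open Filter Topology Metric
open scoped SchwartzMap LineDeriv

namespace Literature.Analysis.Distribution

variable {E F : Type*} [NormedAddCommGroup E] [NormedSpace ℝ E] [NormedAddCommGroup F]
  [NormedSpace ℝ F]

/-! ## Estimates for translates -/

section Estimates

variable (Φ : 𝓢(E, F))

/-- Weight transfer at unit distance: if `‖z - x‖ ≤ 1` then
`‖x‖^k ‖D^m Φ(z)‖ ≤ 2^k (p_{k,m}(Φ) + p_{0,m}(Φ))`. [folklore] -/
theorem pow_mul_norm_iteratedFDeriv_le_of_dist_le_one (k m : ℕ) {x z : E} (hz : ‖z - x‖ ≤ 1) :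
    ‖x‖ ^ k * ‖iteratedFDeriv ℝ m Φ z‖
      ≤ 2 ^ k * (SchwartzMap.seminorm ℝ k m Φ + SchwartzMap.seminorm ℝ 0 m Φ) := by
  have hp0 : 0 ≤ SchwartzMap.seminorm ℝ 0 m Φ := apply_nonneg _ _
  have hpk : 0 ≤ SchwartzMap.seminorm ℝ k m Φ := apply_nonneg _ _
  have hx : ‖x‖ ≤ ‖z‖ + 1 := by
    have h := norm_le_insert' x z
    rw [norm_sub_rev] at hz
    linarith
  have hD0 : ‖iteratedFDeriv ℝ m Φ z‖ ≤ SchwartzMap.seminorm ℝ 0 m Φ :=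
    SchwartzMap.norm_iteratedFDeriv_le_seminorm ℝ Φ m z
  have hDk : ‖z‖ ^ k * ‖iteratedFDeriv ℝ m Φ z‖ ≤ SchwartzMap.seminorm ℝ k m Φ :=
    SchwartzMap.le_seminorm ℝ k m Φ z
  by_cases hz1 : ‖z‖ ≤ 1
  · have hx2 : ‖x‖ ≤ 2 := by linarith
    have hxk : ‖x‖ ^ k ≤ 2 ^ k := pow_le_pow_left₀ (norm_nonneg _) hx2 k
    calc ‖x‖ ^ k * ‖iteratedFDeriv ℝ m Φ z‖ ≤ 2 ^ k * SchwartzMap.seminorm ℝ 0 m Φ :=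
          mul_le_mul hxk hD0 (norm_nonneg _) (pow_nonneg (by norm_num) _)
      _ ≤ 2 ^ k * (SchwartzMap.seminorm ℝ k m Φ + SchwartzMap.seminorm ℝ 0 m Φ) := by
          gcongr
          linarith
  · have hz1' : 1 ≤ ‖z‖ := (not_le.mp hz1).le
    have hx2 : ‖x‖ ≤ 2 * ‖z‖ := by linarith
    have hxk : ‖x‖ ^ k ≤ 2 ^ k * ‖z‖ ^ k := by
      rw [← mul_pow]
      exact pow_le_pow_left₀ (norm_nonneg _) hx2 k
    calc ‖x‖ ^ k * ‖iteratedFDeriv ℝ m Φ z‖ ≤ 2 ^ k * ‖z‖ ^ k * ‖iteratedFDeriv ℝ m Φ z‖ :=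
          mul_le_mul_of_nonneg_right hxk (norm_nonneg _)
      _ = 2 ^ k * (‖z‖ ^ k * ‖iteratedFDeriv ℝ m Φ z‖) := mul_assoc _ _ _
      _ ≤ 2 ^ k * SchwartzMap.seminorm ℝ k m Φ := by gcongr
      _ ≤ 2 ^ k * (SchwartzMap.seminorm ℝ k m Φ + SchwartzMap.seminorm ℝ 0 m Φ) := by
          gcongr
          linarith

/-- Mean value for `D^n Φ` along a translate: a bound `B` for `‖D^{n+1} Φ‖` on `closedBall x ‖v‖`
gives `‖D^n Φ(x - v) - D^n Φ(x)‖ ≤ B ‖v‖`. [folklore] -/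
theorem norm_iteratedFDeriv_sub_apply_sub_le (n : ℕ) (x v : E) {B : ℝ}
    (hB : ∀ z ∈ closedBall x ‖v‖, ‖iteratedFDeriv ℝ (n + 1) Φ z‖ ≤ B) :
    ‖iteratedFDeriv ℝ n Φ (x - v) - iteratedFDeriv ℝ n Φ x‖ ≤ B * ‖v‖ := by
  have hd : Differentiable ℝ (iteratedFDeriv ℝ n (Φ : E → F)) :=
    (Φ.smooth (n + 1 : ℕ)).differentiable_iteratedFDeriv (by exact_mod_cast Nat.lt_succ_self n)
  have hB' : ∀ z ∈ closedBall x ‖v‖, ‖fderiv ℝ (iteratedFDeriv ℝ n (Φ : E → F)) z‖ ≤ B := by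
    intro z hz
    rw [norm_fderiv_iteratedFDeriv]
    exact hB z hz
  have hmem : x - v ∈ closedBall x ‖v‖ := by
    rw [mem_closedBall, dist_eq_norm, sub_sub_cancel_left, norm_neg]
  have h := (convex_closedBall x ‖v‖).norm_image_sub_le_of_norm_fderiv_le
    (fun z _ => hd.differentiableAt) hB' (mem_closedBall_self (norm_nonneg _)) hmem
  rwa [sub_sub_cancel_left, norm_neg] at h

/-- The weighted translation estimate: for `‖v‖ ≤ 1`,
`‖x‖^k ‖D^n Φ(x - v) - D^n Φ(x)‖ ≤ 2^k (p_{k,n+1}(Φ) + p_{0,n+1}(Φ)) ‖v‖`. [folklore] -/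
theorem pow_mul_norm_iteratedFDeriv_translate_sub_le (k n : ℕ) (x : E) {v : E} (hv : ‖v‖ ≤ 1) :
    ‖x‖ ^ k * ‖iteratedFDeriv ℝ n Φ (x - v) - iteratedFDeriv ℝ n Φ x‖
      ≤ 2 ^ k * (SchwartzMap.seminorm ℝ k (n + 1) Φ + SchwartzMap.seminorm ℝ 0 (n + 1) Φ) * ‖v‖ := by
  set K : ℝ := 2 ^ k * (SchwartzMap.seminorm ℝ k (n + 1) Φ + SchwartzMap.seminorm ℝ 0 (n + 1) Φ)
    with hK
  have hK0 : 0 ≤ K := mul_nonneg (pow_nonneg (by norm_num) _)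
    (add_nonneg (apply_nonneg _ _) (apply_nonneg _ _))
  -- points of the ball are within distance `1` of `x`
  have hnear : ∀ z ∈ closedBall x ‖v‖, ‖z - x‖ ≤ 1 := by
    intro z hz
    rw [mem_closedBall, dist_eq_norm] at hz
    exact hz.trans hv
  rcases eq_or_ne x 0 with rfl | hx
  · cases k with
    | zero =>
      rw [pow_zero, one_mul]
      refine norm_iteratedFDeriv_sub_apply_sub_le Φ n 0 v fun z hz => ?_
      have h := pow_mul_norm_iteratedFDeriv_le_of_dist_le_one Φ 0 (n + 1) (hnear z hz)
      rwa [pow_zero, one_mul] at h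
    | succ k =>
      rw [norm_zero, zero_pow (Nat.succ_ne_zero k), zero_mul]
      exact mul_nonneg hK0 (norm_nonneg _)
  · have hxk : 0 < ‖x‖ ^ k := pow_pos (norm_pos_iff.mpr hx) k
    have hB : ∀ z ∈ closedBall x ‖v‖, ‖iteratedFDeriv ℝ (n + 1) Φ z‖ ≤ K / ‖x‖ ^ k := by
      intro z hz
      rw [le_div_iff₀ hxk, mul_comm]
      exact pow_mul_norm_iteratedFDeriv_le_of_dist_le_one Φ k (n + 1) (hnear z hz)
    have h := norm_iteratedFDeriv_sub_apply_sub_le Φ n x v hB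
    calc ‖x‖ ^ k * ‖iteratedFDeriv ℝ n Φ (x - v) - iteratedFDeriv ℝ n Φ x‖
        ≤ ‖x‖ ^ k * (K / ‖x‖ ^ k * ‖v‖) := mul_le_mul_of_nonneg_left h hxk.le
      _ = K * ‖v‖ := by field_simp

variable (𝕜 : Type*) [RCLike 𝕜] [NormedSpace 𝕜 F]

/-- **Seminorm estimate for translates**: for `‖v‖ ≤ 1`,
`p_{k,n}(τ_v Φ - Φ) ≤ 2^k (p_{k,n+1}(Φ) + p_{0,n+1}(Φ)) ‖v‖`. [folklore] -/
theorem seminorm_compSubConstCLM_sub_self_le {v : E} (hv : ‖v‖ ≤ 1) (k n : ℕ) :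
    SchwartzMap.seminorm ℝ k n (SchwartzMap.compSubConstCLM 𝕜 v Φ - Φ)
      ≤ 2 ^ k * (SchwartzMap.seminorm ℝ k (n + 1) Φ + SchwartzMap.seminorm ℝ 0 (n + 1) Φ) * ‖v‖ := by
  refine SchwartzMap.seminorm_le_bound ℝ k n _
    (mul_nonneg (mul_nonneg (pow_nonneg (by norm_num) _)
      (add_nonneg (apply_nonneg _ _) (apply_nonneg _ _))) (norm_nonneg _)) fun x => ?_
  have hcoe : ((SchwartzMap.compSubConstCLM 𝕜 v Φ - Φ : 𝓢(E, F)) : E → F)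
      = (fun y => Φ (y - v)) - (Φ : E → F) := by
    ext y
    simp
  have hc : ContDiff ℝ n (fun y : E => Φ (y - v)) := (Φ.smooth n).comp (contDiff_id.sub contDiff_const)
  rw [hcoe, iteratedFDeriv_sub_apply hc.contDiffAt ((Φ.smooth n).contDiffAt),
    iteratedFDeriv_comp_sub' n v]
  exact pow_mul_norm_iteratedFDeriv_translate_sub_le Φ k n x hv

/-- The uniform second-order Taylor estimate for translates:
`‖Φ(x - v) - Φ(x) + DΦ(x) v‖ ≤ p_{0,2}(Φ) ‖v‖²`. [folklore] -/
theorem norm_translate_sub_add_fderiv_le (x v : E) :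
    ‖Φ (x - v) - Φ x + fderiv ℝ Φ x v‖ ≤ SchwartzMap.seminorm ℝ 0 2 Φ * ‖v‖ ^ 2 := by
  have hp : 0 ≤ SchwartzMap.seminorm ℝ 0 2 Φ := apply_nonneg _ _
  have hdd : Differentiable ℝ (fderiv ℝ (Φ : E → F)) := (SchwartzMap.fderivCLM ℝ E F Φ).differentiable
  have hB : ∀ z ∈ closedBall x ‖v‖, ‖fderiv ℝ (fderiv ℝ (Φ : E → F)) z‖ ≤ SchwartzMap.seminorm ℝ 0 2 Φ := by
    intro z _
    rw [← norm_iteratedFDeriv_one, norm_iteratedFDeriv_fderiv]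
    exact SchwartzMap.norm_iteratedFDeriv_le_seminorm ℝ Φ (1 + 1) z
  have hLip : ∀ z ∈ closedBall x ‖v‖,
      ‖fderiv ℝ (Φ : E → F) z - fderiv ℝ Φ x‖ ≤ SchwartzMap.seminorm ℝ 0 2 Φ * ‖v‖ := by
    intro z hz
    have h := (convex_closedBall x ‖v‖).norm_image_sub_le_of_norm_fderiv_le
      (fun w _ => hdd.differentiableAt) hB (mem_closedBall_self (norm_nonneg _)) hz
    rw [mem_closedBall, dist_eq_norm] at hz
    exact h.trans (mul_le_mul_of_nonneg_left hz hp)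
  have hmem : x - v ∈ closedBall x ‖v‖ := by
    rw [mem_closedBall, dist_eq_norm, sub_sub_cancel_left, norm_neg]
  have hT := (convex_closedBall x ‖v‖).norm_image_sub_le_of_norm_fderiv_le'
    (fun w _ => Φ.differentiableAt) hLip (mem_closedBall_self (norm_nonneg _)) hmem
  rw [sub_sub_cancel_left, norm_neg, map_neg, sub_neg_eq_add] at hT
  calc ‖Φ (x - v) - Φ x + fderiv ℝ Φ x v‖ ≤ SchwartzMap.seminorm ℝ 0 2 Φ * ‖v‖ * ‖v‖ := hT
    _ = SchwartzMap.seminorm ℝ 0 2 Φ * ‖v‖ ^ 2 := by ring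

end Estimates

/-! ## The Schwartz-topology derivative of a translation flow -/

/-- **Smooth vectors for translation flows.**  `v : ℝ → E` with `v 0 = 0`, `HasDerivAt v a 0`; then
`s⁻¹ • (τ_{v s} Φ - Φ) → -∂_{a} Φ` in `𝓢(E, F)` (`τ_c Φ = Φ(· - c)`), for every `Φ`. [folklore] -/
theorem tendsto_compSubConstCLM_sub_div (𝕜 : Type*) [RCLike 𝕜] [NormedSpace 𝕜 F]
    {v : ℝ → E} {a : E} (hv0 : v 0 = 0) (hv : HasDerivAt v a 0)
    (Φ : 𝓢(E, F)) :
    Tendsto (fun s : ℝ => s⁻¹ • (SchwartzMap.compSubConstCLM 𝕜 (v s) Φ - Φ)) (𝓝[≠] 0)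
      (𝓝 (-(∂_{a} Φ))) := by
  have hslope : Tendsto (fun s : ℝ => s⁻¹ • v s) (𝓝[≠] 0) (𝓝 a) := by
    have h := hasDerivAt_iff_tendsto_slope_zero.mp hv
    simpa only [zero_add, hv0, sub_zero] using h
  have hcont : Tendsto v (𝓝[≠] 0) (𝓝 0) := by
    have h := hv.continuousAt.tendsto
    rw [hv0] at h
    exact h.mono_left nhdsWithin_le_nhds
  have hsmall : ∀ᶠ s in 𝓝[≠] (0 : ℝ), ‖v s‖ ≤ 1 := by
    have h := hcont.norm
    rw [norm_zero] at h
    exact ((tendsto_order.1 h).2 1 one_pos).mono fun s hs => hs.le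
  have hδ : Tendsto (fun s : ℝ => ‖s⁻¹ • v s - a‖) (𝓝[≠] 0) (𝓝 0) := by
    have h := (tendsto_sub_nhds_zero_iff.2 hslope).norm
    rwa [norm_zero] at h
  have hbig : ∀ᶠ s in 𝓝[≠] (0 : ℝ), ‖v s‖ ≤ (‖a‖ + 1) * |s| := by
    have h1 : ∀ᶠ s in 𝓝[≠] (0 : ℝ), ‖s⁻¹ • v s - a‖ < 1 := (tendsto_order.1 hδ).2 1 one_pos
    filter_upwards [h1, self_mem_nhdsWithin] with s hs hs0
    have hs0' : s ≠ 0 := hs0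
    have hspos : 0 < |s| := abs_pos.2 hs0'
    have h2 : ‖s⁻¹ • v s‖ ≤ ‖a‖ + 1 := by
      have := norm_le_norm_add_norm_sub' (s⁻¹ • v s) a
      linarith
    rw [norm_smul, norm_inv, Real.norm_eq_abs] at h2
    calc ‖v s‖ = |s| * (|s|⁻¹ * ‖v s‖) := by field_simp
      _ ≤ |s| * (‖a‖ + 1) := by gcongr
      _ = (‖a‖ + 1) * |s| := mul_comm _ _
  refine tendsto_of_seminorm_bounded_of_uniform (fun k n => ?_) (fun ε hε => ?_)
  · -- bounded seminorms
    set K : ℝ := 2 ^ k * (SchwartzMap.seminorm ℝ k (n + 1) Φ + SchwartzMap.seminorm ℝ 0 (n + 1) Φ)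
      with hK
    have hK0 : 0 ≤ K := mul_nonneg (pow_nonneg (by norm_num) _)
      (add_nonneg (apply_nonneg _ _) (apply_nonneg _ _))
    refine ⟨K * (‖a‖ + 1), ?_⟩
    filter_upwards [hsmall, hbig, self_mem_nhdsWithin] with s hs1 hs2 hs0
    have hs0' : s ≠ 0 := hs0
    have hspos : 0 < |s| := abs_pos.2 hs0'
    have hsem := seminorm_compSubConstCLM_sub_self_le Φ 𝕜 hs1 k n
    rw [map_smul_eq_mul, norm_inv, Real.norm_eq_abs]
    calc |s|⁻¹ * SchwartzMap.seminorm ℝ k n (SchwartzMap.compSubConstCLM 𝕜 (v s) Φ - Φ)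
        ≤ |s|⁻¹ * (K * ((‖a‖ + 1) * |s|)) := by
          gcongr
          exact hsem.trans (mul_le_mul_of_nonneg_left hs2 hK0)
      _ = K * (‖a‖ + 1) := by field_simp
  · -- uniform convergence
    have hp01 : 0 ≤ SchwartzMap.seminorm ℝ 0 1 Φ := apply_nonneg _ _
    have hp02 : 0 ≤ SchwartzMap.seminorm ℝ 0 2 Φ := apply_nonneg _ _
    have habs : Tendsto (fun s : ℝ => |s|) (𝓝[≠] 0) (𝓝 0) :=
      (continuous_abs.tendsto' (0 : ℝ) 0 abs_zero).mono_left nhdsWithin_le_nhds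
    have t1 : Tendsto (fun s : ℝ => SchwartzMap.seminorm ℝ 0 2 Φ * (‖a‖ + 1) ^ 2 * |s|)
        (𝓝[≠] 0) (𝓝 0) := by
      simpa using habs.const_mul (SchwartzMap.seminorm ℝ 0 2 Φ * (‖a‖ + 1) ^ 2)
    have t2 : Tendsto (fun s : ℝ => SchwartzMap.seminorm ℝ 0 1 Φ * ‖s⁻¹ • v s - a‖)
        (𝓝[≠] 0) (𝓝 0) := by
      simpa using hδ.const_mul (SchwartzMap.seminorm ℝ 0 1 Φ)
    have e1 := (tendsto_order.1 t1).2 (ε / 2) (by positivity)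
    have e2 := (tendsto_order.1 t2).2 (ε / 2) (by positivity)
    filter_upwards [hbig, self_mem_nhdsWithin, e1, e2] with s hs2 hs0 h1 h2
    have hs0' : s ≠ 0 := hs0
    have hspos : 0 < |s| := abs_pos.2 hs0'
    intro x
    have hq : (s⁻¹ • (SchwartzMap.compSubConstCLM 𝕜 (v s) Φ - Φ)) x - (-(∂_{a} Φ)) x
        = s⁻¹ • (Φ (x - v s) - Φ x + fderiv ℝ Φ x (v s)) - fderiv ℝ Φ x (s⁻¹ • v s - a) := by
      rw [smul_apply, sub_apply, SchwartzMap.compSubConstCLM_apply, neg_apply,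
        SchwartzMap.lineDerivOp_apply_eq_fderiv]
      simp only [map_sub, map_smul, smul_sub, smul_add]
      abel
    rw [hq]
    have hTaylor := norm_translate_sub_add_fderiv_le Φ x (v s)
    have h01 : ‖fderiv ℝ (Φ : E → F) x‖ ≤ SchwartzMap.seminorm ℝ 0 1 Φ := by
      rw [← norm_iteratedFDeriv_one]
      exact SchwartzMap.norm_iteratedFDeriv_le_seminorm ℝ Φ 1 x
    calc ‖s⁻¹ • (Φ (x - v s) - Φ x + fderiv ℝ Φ x (v s)) - fderiv ℝ Φ x (s⁻¹ • v s - a)‖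
        ≤ ‖s⁻¹ • (Φ (x - v s) - Φ x + fderiv ℝ Φ x (v s))‖ + ‖fderiv ℝ Φ x (s⁻¹ • v s - a)‖ :=
          norm_sub_le _ _
      _ ≤ |s|⁻¹ * (SchwartzMap.seminorm ℝ 0 2 Φ * ‖v s‖ ^ 2)
            + SchwartzMap.seminorm ℝ 0 1 Φ * ‖s⁻¹ • v s - a‖ := by
          refine add_le_add ?_ ?_
          · rw [norm_smul, norm_inv, Real.norm_eq_abs]
            exact mul_le_mul_of_nonneg_left hTaylor (inv_nonneg.2 hspos.le)
          · exact (ContinuousLinearMap.le_opNorm _ _).trans (mul_le_mul_of_nonneg_right h01 (norm_nonneg _))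
      _ ≤ |s|⁻¹ * (SchwartzMap.seminorm ℝ 0 2 Φ * ((‖a‖ + 1) * |s|) ^ 2)
            + SchwartzMap.seminorm ℝ 0 1 Φ * ‖s⁻¹ • v s - a‖ := by
          gcongr
      _ = SchwartzMap.seminorm ℝ 0 2 Φ * (‖a‖ + 1) ^ 2 * |s|
            + SchwartzMap.seminorm ℝ 0 1 Φ * ‖s⁻¹ • v s - a‖ := by
          field_simp
      _ ≤ ε / 2 + ε / 2 := add_le_add h1.le h2.le
      _ = ε := by ring

/-- The straight-line case `v s = s • a`: `s⁻¹ • (τ_{s a} Φ - Φ) → -∂_{a} Φ` in `𝓢(E, F)`. [folklore] -/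
theorem tendsto_compSubConstCLM_smul_sub_div' (𝕜 : Type*) [RCLike 𝕜] [NormedSpace 𝕜 F]
    (a : E) (Φ : 𝓢(E, F)) :
    Tendsto (fun s : ℝ => s⁻¹ • (SchwartzMap.compSubConstCLM 𝕜 (s • a) Φ - Φ)) (𝓝[≠] 0)
      (𝓝 (-(∂_{a} Φ))) :=
  tendsto_compSubConstCLM_sub_div 𝕜 (by simp) ((hasDerivAt_id (0 : ℝ)).smul_const a |>.congr_deriv
    (by simp)) Φ

end Literature.Analysis.Distribution
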